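import Mathlib

/-!
# Stub `stub_levelMul` (line `SketchIdeator3G2`, crux `SubgroupIdentityDesigns`)

Fourier levels add under pointwise products.  A function `f : GL_m(𝔽_p) → ℂ` has *Fourier level*
`≤ k` if `f(g) = Σ_M c_M ψ(tr(M g))` (`ψ = ZMod.stdAddChar`, `M` ranging over `M_m(𝔽_p)`) with a
coefficient table `c` vanishing on matrices of rank `> k`.  If `f` has level `≤ a` and `f'` has
level `≤ b`, then `g ↦ f g * f' g` has level `≤ a + b`: multiplying the two expansions gives
`ψ(tr(M g)) ψ(tr(N g)) = ψ(tr((M + N) g))`, so the product is expanded with the convolved table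
`c'' K = Σ_M c_M c'_{K - M}`, and `c'' K = 0` once `rk K > a + b` by rank subadditivity
`rk K ≤ rk M + rk (K - M)`.
-/

-- single-conjunct summit: namespace repeats MatrixMultiplication (summit = sub-problem)
set_option linter.dupNamespace false

noncomputable section

open scoped BigOperators

namespace Summit.MatrixMultiplication.MatrixMultiplication.Theorems.Witnessed

variable {p m : ℕ} [Fact p.Prime]

/-- Rank subadditivity for square matrices over `𝔽_p`: `rk (A + B) ≤ rk A + rk B`
(the range of `A + B` lies in the sum of the ranges). -/
private theorem rank_add_le_zmod (A B : Matrix (Fin m) (Fin m) (ZMod p)) :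
    (A + B).rank ≤ A.rank + B.rank := by
  unfold Matrix.rank
  rw [Matrix.mulVecLin_add]
  exact (Submodule.finrank_mono (LinearMap.range_add_le _ _)).trans
    (Submodule.finrank_add_le_finrank_add_finrank _ _)

/-- **Levels add under pointwise products.**  If `f` has Fourier level `≤ a` and `f'` has Fourier
level `≤ b` (expansions `Σ_M c_M ψ(tr(M g))` with coefficients vanishing above rank `a`, resp. `b`),
then `g ↦ f g * f' g` has Fourier level `≤ a + b`, witnessed by the convolved coefficient table
`K ↦ Σ_M c_M c'_{K - M}`. -/
theorem stub_levelMul {a b : ℕ} {f f' : Matrix.GeneralLinearGroup (Fin m) (ZMod p) → ℂ}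
    (hf : ∃ c : Matrix (Fin m) (Fin m) (ZMod p) → ℂ, (∀ M, a < M.rank → c M = 0) ∧
      ∀ g : Matrix.GeneralLinearGroup (Fin m) (ZMod p), f g =
        ∑ M : Matrix (Fin m) (Fin m) (ZMod p),
          c M * ZMod.stdAddChar (Matrix.trace (M * (g : Matrix (Fin m) (Fin m) (ZMod p)))))
    (hf' : ∃ c : Matrix (Fin m) (Fin m) (ZMod p) → ℂ, (∀ M, b < M.rank → c M = 0) ∧
      ∀ g : Matrix.GeneralLinearGroup (Fin m) (ZMod p), f' g =
        ∑ M : Matrix (Fin m) (Fin m) (ZMod p),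
          c M * ZMod.stdAddChar (Matrix.trace (M * (g : Matrix (Fin m) (Fin m) (ZMod p))))) :
    ∃ c : Matrix (Fin m) (Fin m) (ZMod p) → ℂ, (∀ M, a + b < M.rank → c M = 0) ∧
      ∀ g : Matrix.GeneralLinearGroup (Fin m) (ZMod p), f g * f' g =
        ∑ M : Matrix (Fin m) (Fin m) (ZMod p),
          c M * ZMod.stdAddChar (Matrix.trace (M * (g : Matrix (Fin m) (Fin m) (ZMod p)))) := by
  classical
  obtain ⟨c, hc, hfc⟩ := hf
  obtain ⟨c', hc', hfc'⟩ := hf'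
  refine ⟨fun K => ∑ M : Matrix (Fin m) (Fin m) (ZMod p), c M * c' (K - M), ?_, ?_⟩
  · -- support: if `a + b < rk K` then every summand `c M * c' (K - M)` vanishes
    intro K hK
    refine Finset.sum_eq_zero fun M _ => ?_
    by_cases hM : a < M.rank
    · rw [hc M hM, zero_mul]
    · have hKM : b < (K - M).rank := by
        by_contra h
        have hle := rank_add_le_zmod M (K - M)
        rw [add_sub_cancel] at hle
        omega
      rw [hc' _ hKM, mul_zero]
  · -- expansion: multiply out, use `ψ(x) ψ(y) = ψ(x + y)` and reindex `N ↦ M + N`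
    intro g
    rw [hfc g, hfc' g, Finset.sum_mul_sum]
    simp only [Finset.sum_mul]
    conv_rhs => rw [Finset.sum_comm]
    refine Finset.sum_congr rfl fun M _ => ?_
    refine Fintype.sum_equiv (Equiv.addLeft M) _ _ fun N => ?_
    simp only [Equiv.coe_addLeft, add_sub_cancel_left, Matrix.add_mul, Matrix.trace_add,
      AddChar.map_add_eq_mul]
    ring

end Summit.MatrixMultiplication.MatrixMultiplication.Theorems.Witnessed

end
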